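import Mathlib
import HarnessLib
import HarnessLib.Audit
import Summits.SmoothPoincare4.Statement
import Literature.Topology.FourManifolds.SmoothTriangulation
import HarnessLib.Audit.Status.Attr

/-!
Route: RootDecompAA

# Route RootDecompAA — SPC4 ⟸ homotopy 4-spheres with a smooth triangulation of ≤ 86400
four-simplices are standard (finite, census-instrumented) ∧ those with none are standard (declared
residual) — the facet-number dial

X = F ∧ T (root decomposition cell decomp-sp4, lens 5 «finite/base range + asymptotic regime +
bridge», gen 8, node FacetCensus — NEW
OR-sibling root route; letter Z advisory = next free after X (GapLocality) and Y (TwistedCarving),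
the writer substitutes the birth letter in the name; kernel file
decomp-sp4-lens-5/g8/FacetCensus.lean: `closes`/`closes_inline` (= this route's `closes`, 2/2
binders), `summit_iff : S ↔ F ∧ T` EXACT,
S ⟹ each piece, the dial lemmas). Grade a smooth homotopy 4-sphere Σ by its FACET NUMBER sf(Σ) = the
least number of 4-simplices of a
Whitehead smooth triangulation of Σ (tree predicate
`Literature.Topology.FourManifolds.IsSmoothTriangulation 4 K h`: a finite Euclidean
simplicial complex K with |K| ≃ₜ Σ a C^∞ immersion on every closed simplex; every PL triangulation
of the PL structure a smoothing comes
from qualifies). F = `SmallSpheresStandard` (NEW crux, FINITE RANGE, census-instrumented): every Σ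
with sf(Σ) ≤ 86400 = 6·(5!)² is
diffeomorphic to S⁴. T = `LargeSpheresStandard` (NEW crux, DECLARED RESIDUAL): every Σ with sf(Σ) >
86400 is diffeomorphic to S⁴. The bound
is the reach of the Budney–Burton census as classified by Burke et al.: a generalised triangulation
with n pentachora has simplicial second
barycentric subdivision with (5!)²·n four-simplices, so F ⟹ «every ≤ 6-pentachoron triangulation of
a homotopy 4-sphere is PL-standard»,
whose only unresolved rows are S⁴_C = eAMPcaabcddd+aoa+aAa8aQara (4 pentachora; sd² = 57 600 facets)
and ≤ 3 six-pentachoron classes.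
Lean: `Summit.SmoothPoincare4.SmoothPoincare4.Theses.RootDecompAA.SmallSpheresStandard ∧
Summit.SmoothPoincare4.SmoothPoincare4.Theses.RootDecompAA.LargeSpheresStandard`

## Assembly
Pure logic over the two binders (route/glue.lean = kernel `FacetCensus.closes_inline`, axioms
propext/Classical.choice/Quot.sound): given
M ≃ₕ S⁴, case on whether M admits a Whitehead smooth triangulation with ≤ 86400 four-simplices; F
decides the first case, T the second.
Exactness and necessity are kernel theorems of the lens file: `summit_iff : SmoothPoincare4 ↔ F ∧
T`, `small_of_summit`, `large_of_summit`,
and the dial `summit_iff_pl N : S ↔ SmallPL N ∧ LargePL N` for every N with `smallPL_anti` (F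
antitone in N), `largePL_mono` (T monotone),
`largePL_iff_summit_of_small` (T ≡ S modulo F — declared), `largePL_of_existsSmallPL`,
`summit_of_small_of_exists` (existence form).

Rationale: WHY THIS LINE. Every homotopy 4-sphere has a finite facet number (Whitehead 1940: smooth manifolds
carry smooth triangulations, [Munkres1966, §8–10]) and
in dimension 4 PL = DIFF (Cerf Γ₄ = 0, Hirsch–Mazur smoothing theory), so SPC4 is equivalent to
«every combinatorial homotopy 4-sphere is
bistellarly standard» (Pachner) and can be FILTERED BY SIZE: this is the one grading of Σ by a
combinatorial quantity, and it brings the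
computational-PL-topology community's instrument to the cell — Regina/Katie Pachner-graph searches,
which classified all 440 495
six-pentachoron triangulations of closed orientable 4-manifolds except ≤ 4 PL classes of S⁴
(arXiv:2412.04768, DCG 2026, §4.3–4.4, §5;
survey arXiv:2502.01757). The base of the dial is a theorem of f-vector combinatorics: a
triangulated 4-sphere with ≤ 14 facets has ≤ 8
vertices by the Lower Bound Theorem f₄ ≥ 4f₀ − 18 (Barnette 1973, Kalai 1987) and PL 4-spheres with
≤ 8 = d+3 vertices are polytopal
(Mani 1972, [corpus:book:graham1996-handbook-combinatorics-vol-1 p.889 Thm 4.12]), hence standard.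
The first undecided named row is the
4-pentachoron sphere S⁴_C containing the cut-open Cappell–Shaneson complex C = cHIbbb0bRbpb
(arXiv:2412.04768 §5: Prop. 9 — any
standardising Pachner sequence passes through ≥ 12 pentachora; Conj. 2 — the ball B⁴_C =
eGzMkabcdddcaGa8aAa0awa is PL-standard), i.e. the
Cappell–Shaneson family (P3) sits INSIDE the finite piece. Imported: computational topology
(instrument), polytope theory (base), smoothing
theory (dictionary); the catalogued rung is LADDER §C3(ii) («census conjecture»), which no route
carried before.

Workshop record (writer decomp-sp4-writer-1 g3, cell decomp-sp4, rung 0): NODE HOME/STATUS.md line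
355 (lens-5 g8, 2026-08-30T07:53:57Z; package HOME/decomp-sp4-lens-5/g8/, SHA256SUMS verified by the
writer, all OK); kernel decomp-sp4-lens-5/g8/FacetCensus.lean sha256
06ca77c49157d24c667c332e15190f3fa9a5dcedf8b1d6964ac0433b3f346291 (rc 0 · 0 sorry · 13 axiom guards
std); route package route/{Route.md, route.json, glue.lean (case split, 2/2 binders),
RootDecompZ.rendered.lean, native_check.raw.txt (verdict OK), tribunal_quick.txt (tk=PROVISIONAL)}
adopted under the birth letter AA (X = GapLocality 07:41:29Z, Y = TwistedCarving 07:51:27Z; letters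
in birth order); no pooled items, no aliases, no definition at birth; census data
HOME/census/COSTUME-CENSUS-v5.md sha256
cb89ced12168b4f3fb419105fb427a97d0a3343f33794e090144449551229764. Critic verdict: critic
decomp-sp4-crit-1 g3 CLEARED HOME/STATUS.md line 361 2026-08-30T07:59:38Z (ledger row 80; advisory
letter Z — taken meanwhile by route-SmoothPoincare4-RootDecompZ = lens-3 g8 CrossSectionTransfer,
opened 08:00:44Z by the lens seat itself; FacetCensus is therefore born under the first two-letter
slug AA); per-piece critic tags are appended to each item. Writer fix at filing: the package’s ##
Barriers lines named the catalogue FILES (TopologicalInvariantsBlind, …); the first `route open`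
(08:04:39Z) bounced «Barriers names unknown barrier decl(s)», so each line now names the barrier
DECL defined in that file (TopologicalBarrierFour, StableBarrierFour, GaugeSumBarrierFour,
HCobordismBarrierFour, HCobordismInvariantBarrierFour, CappellShanesonFamilyBarrier,
StrictPropertyTwoRBarrier, LowGenusTrisectionBarrier, TwistedSphereBarrierFour) with the file in
parentheses — placement text unchanged.

RANKED CRUXES. #2 SmallSpheresStandard (crux) — F (NEW, FINITE RANGE, the node's INSTRUMENTED
piece): for every smooth homotopy 4-sphere M (Statement binders, e : M ≃ₕ S⁴), IF M admits a
Whitehead smooth triangulation (K ⊆ E^{N₀} a finite Euclidean simplicial complex, h : |K| ≃ₜ M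
smooth with injective derivative on every closed simplex — tree `IsSmoothTriangulation 4 K h`) whose
number of faces with 5 vertices is ≤ 86400, THEN M ≅ S⁴. Finitely many isomorphism types of
complexes are concerned; decided rows = the census classes connected to the standard sphere and
every complex with ≤ 8 vertices; undecided named rows = S⁴_C and ≤ 3 six-pentachoron classes.
[critic decomp-sp4-crit-1 g3 CLEARED HOME/STATUS.md line 361 2026-08-30T07:59:38Z (ledger row 80;
advisory letter Z — taken meanwhile by route-SmoothPoincare4-RootDecompZ = lens-3 g8
CrossSectionTransfer, opened 08:00:44Z by the lens seat itself; FacetCensus is therefore born under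
the first two-letter slug AA): F NEW crux r2 · FINITE RANGE · WEAKER by FINITENESS only (F ⟹ S would
need sf bounded on homotopy spheres — nothing in print; BC2 F→S, T→S, F→T, T→F 10/10 FAIL) · NOT
DECIDABLE AS A WHOLE (rows decided only positively by exhibited Pachner sequences / polytopality) ·
DECIDED BASE F(14) (LBT + Mani 1972 polytopal [corpus:book:graham1996-handbook-combinatorics-vol-1
p.889 Thm 4.12]) · INSTRUMENTED-IN-PART via the sd² dictionary F(14400·n) ⟹ CENSUS(n) · UNDECIDED
NAMED rows S⁴_C (57 600 facets; [corpus:paper:arxiv-2412.04768 p.11]) + ≤ 3 six-pentachoron classes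
(kit ask T-PL6) · undecided unnamed bulk honestly tagged · BC7 CLEAN] [difficulty: open-problem]
(why it might fail: S⁴_C (eAMPcaabcddd+aoa+aAa8aQara, 4 pentachora, sd² = 57600 facets) or one of
the ≤ 3 unresolved 6-pentachoron S⁴-classes is PL-exotic — excess-height-6 searches cannot
standardise them (arXiv:2412.04768 Prop. 9); that would refute SPC4 itself.) [arXiv:2412.04768,
arXiv:2502.01757, Munkres1966, Whitehead1940, book:graham1996-handbook-combinatorics-vol-1]
#3 LargeSpheresStandard (crux) — T (NEW, DECLARED RESIDUAL — the dial's complement): for every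
smooth homotopy 4-sphere M (Statement binders), IF M admits NO Whitehead smooth triangulation with ≤
86400 four-simplices, THEN M ≅ S⁴. Kernel: T ⟺ S given F (`large_iff_summit_of_small`), S ⟹ T,
E(86400) ⟹ T where E(N) = «every homotopy 4-sphere has sf ≤ N» (E ⟹ finitely many smooth structures
on S⁴, on paper). No decided rows are possible without lower bounds on sf beyond f-vector
inequalities: the honest residual. [critic decomp-sp4-crit-1 g3 CLEARED HOME/STATUS.md line 361
2026-08-30T07:59:38Z (ledger row 80; advisory letter Z — taken meanwhile by
route-SmoothPoincare4-RootDecompZ = lens-3 g8 CrossSectionTransfer, opened 08:00:44Z by the lens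
seat itself; FacetCensus is therefore born under the first two-letter slug AA): T NEW crux r3 ·
DECLARED RESIDUAL · ≡ S mod F (kernel large_iff_summit_of_small) · distribution shape (c)
«everything minus a finite set», ADMISSIBLE under R1 + ruling (a) 281 because the finite side has
NAMED OPEN ROWS with a working external instrument (T-PL6) and the dial is kernel-monotone
(summit_iff_pl N, smallPL_anti, largePL_mono) · BC7 CLEAN] [difficulty: open-problem] (why it might
fail: An exotic 4-sphere all of whose smooth triangulations are large (sf > 86400) — e.g. a Gluck
twist of a high-crossing 2-knot if exotic; nothing bounds sf of a homotopy sphere from above, so T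
is SPC4 outside a finite set of PL types.) [arXiv:2412.04768, Munkres1966, Kirby1997,
FreedmanGompfMorrisonWalker2010]

TWO-LAYER PLAN. F is a finite conjunction over isomorphism types of complexes; its foreseen glued
split is BY NAMED ROW once a prover wants it:
F ⟸ F_census ∧ F_rest with F_census := «the PL types of the ≤ 6-pentachoron census spheres are
standard» (needs generalised
triangulations / sd² typed — definition request D2) and F_rest the unenumerated simplicial
remainder; or the monotone refinement
F(57600) (isolating S⁴_C) via `smallPL_anti`. T is not split at birth (declared residual); its only
foreseen cut is by a second,
independent complexity (vertex number, or the number of Pachner moves to ∂Δ⁵ — «Pachner distance», a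
genuinely different dial).

KILL CRITERIA. Both pieces are implied by S in the kernel, so a refutation of EITHER piece is an
exotic S⁴ (F: a PL-exotic small triangulation — the
census community's explicit target; T: a large one). The ROUTE is retired as idle (not refuted) if
the cut is shown to expose nothing:
(i) a proof that sf is bounded on homotopy 4-spheres by 86400 (then T is vacuous and F ≡ S;
implausible — it would give finiteness of
smooth structures on S⁴, which nobody has), or (ii) a proof that every ≤ 86400-facet smooth
triangulation of a homotopy sphere has
≤ 8 vertices or is otherwise trivially standard (false: sd²S⁴_C has thousands of vertices). BC2
probes F → S, T → S, F → T, T → F all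
FAIL today (bc/bc2probe.json 10/10); BC7 CLEAN ×2. Superseded if a census theorem «all ≤
n-pentachoron homotopy spheres are standard»
lands for n with (5!)²·n ≥ 86400 together with an enumeration argument for the simplicial remainder
(then F is a theorem and T ≡ S: close
the route `superseded`, keep F as a Literature fact).

NOT DECOMPOSED YET. F is not split by row (S⁴_C, the 6-pentachoron classes, the simplicial
remainder) — rows are census records, not items, until the
generalised-triangulation vocabulary (D2) exists. T is not split. The existence form E(N) («every
homotopy 4-sphere has sf ≤ N»; S ⟹ E(6) on
paper via ∂Δ⁵ radially projected onto the round S⁴, Munkres Def. 8.3 example) is NOT filed: its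
kernel necessity needs a smooth
triangulation of Mathlib's sphere (support S1 below), and E ∧ F is a different (existence ∧
recognition) node whose existence half would
be ≥ FIN; it is recorded in the lens file (`ExistsSmallPL`, `largePL_of_existsSmallPL`,
`summit_of_small_of_exists`).

CHEAPEST FALSIFIER. T-PL6 (census seat; external, reproducible): run the published pipeline (Regina
≥ 7.3 + the authors' USDS/union-find scripts,
arXiv:2412.04768 §4.2–4.3; Katie for B⁴_C) on the FOUR resisting S⁴ classes — S⁴_C =
eAMPcaabcddd+aoa+aAa8aQara and the three
six-pentachoron representatives — with ≥ 100 parallel walkers × 24 h (the paper: «running the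
complete algorithm in parallel on 100+ cores
may produce additional results»; their runs never got below 4 classes in a week on ≤ 80 cores) and,
memory permitting, the exhaustive
Pachner-graph traversal at excess height 8 (14 pentachora), one batch job. Each merge DECIDES a
named row of F (and proves a rung of LADDER
§C3(ii)); a certified disconnection at every height is the first concrete fake-sphere CANDIDATE
surviving all simplifiers (feeds the
negative routes, §6 N2). Desk check that kills the LINE: an a-priori bound sf(Σ) ≤ 86400 for all
homotopy spheres (looked for; none —
no upper bound on triangulation size of homotopy 4-spheres exists in print).

NUMBERS. sf(S⁴) = 6 (∂Δ⁵); sf(Σ) ≥ 6 always; F(N) DECIDED TRUE for N ≤ 14 (LBT ⇒ f₀ ≤ 8 ⇒ Mani ⇒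
polytopal ⇒ standard); census (arXiv:2412.04768
§1, §4.3): 8 / 784 / 440 495 triangulations of closed orientable 4-manifolds with 2 / 4 / 6
pentachora; 405 188 six-pentachoron
triangulations homeomorphic to S⁴ fall into ≤ 4 PL classes (1 standard + ≤ 3 unresolved; 5 classes
within a day on a laptop, 4 after a
week); the unique unresolved 4-pentachoron sphere is S⁴_C; Prop. 9: excess height ≥ 8 (≥ 12
pentachora) is necessary to standardise S⁴_C,
height 6 exhausted. Dictionary constants: sd¹ of a pentachoron = 5! = 120 simplices, sd² = 14 400;
S⁴_C ↦ 57 600 facets, the whole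
≤ 6 census ↦ ≤ 86 400. Kernel certificate: FacetCensus.lean rc 0, 0 sorry, 13 axiom guards =
[propext, Classical.choice, Quot.sound].

DEFINITION REQUESTS. None needed at birth: the size clause is INLINED over the tree predicate
`Literature.Topology.FourManifolds.IsSmoothTriangulation` and
Mathlib's `Geometry.SimplicialComplex` (bodies = route/bodies_*.txt). Wanted later
(Literature/Topology/FourManifolds): D1 `facetCount` /
`IsPure n` helpers on `Geometry.SimplicialComplex` (cosmetic); D2 generalised (Regina-style)
triangulations with their second barycentric
subdivision as a `Geometry.SimplicialComplex` and the isomorphism-signature decoder — this would let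
F_census be typed row by row and
census certificates (Pachner sequences) be CHECKED in Lean via the tree's `Lickorish1999_thm_4_5` /
Pachner facts
(StellarEquivalenceFacts.lean); S1 support «the round S⁴ admits a Whitehead smooth triangulation by
∂Δ⁵» (= AngleDefectCertificates'
non-vacuity support stmt-SmoothPoincare4-7227 without the angle data) — makes E(6) ⟸ S kernel.

Novelty: Searches (2026-08-30): rg over Summits/SmoothPoincare4/SmoothPoincare4/{Theses,Theorems,Cruxes} for
`IsSmoothTriangulation|SimplicialComplex|facet|pentachor`
→ the only routes over smooth triangulations are AngleDefectCertificates (dormant; angle-defect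
CERTIFICATES REC_sc ∧ EX), TropicalFanoSkeleton
(draft; tropical certificate, B47) and LogCYSkeleton (closed) — all certificate-existence ∧
certificate-recognition shapes, none filters
by SIZE; LADDER §C3(ii) records the census conjecture as an un-routed rung; cell nodes A–X grade by
handles / Kirby diagrams / covers /
metrics / stabilisations, never by a combinatorial count (TREE.md v6). `ledger negatives --problem
SmoothPoincare4` → 0 statements. Corpus:
`lit search "eAMPcaabcddd"` → [corpus:paper:arxiv-2412.04768 p.11] only; `lit search --hybrid
"simplicial spheres with d+3 vertices are
polytopal Mani"` → [corpus:book:graham1996-handbook-combinatorics-vol-1 p.889] (Thm 4.12); `lit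
citing arxiv:2412.04768` → [graph:arxiv:2502.01757]
(gems/trisections survey, no resolution of S⁴_C); galaxy `"eAMPca|cHIbbb|pentachoron
census|4-pentachoron" --star all` → 0 relevant rows,
`"PL 4-sphere|exotic PL structure|Pachner graph" --star pdf` → 0 relevant rows. Nearest prior art
found: arXiv:2412.04768 (the census
classification and its Conjecture that the resisting classes are standard), LADDER §C3(ii),
AngleDefectCertificates #11225 (certificate
recognition over the same predicate). Delta: nobody has cut SPC4 into «small PL types» ∧ «lar  [refs: 2412.04768, 2502.01757, paper:arxiv-2412.04768, book:graham1996-handbook-combinatorics-vol-1, arxiv:2412.04768, arxiv:2502.01757]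

Barriers (technique_class: PL triangulations, Pachner census, f-vectors, smoothing): - technique_class: PL triangulations, Pachner census, f-vectors, smoothing
- Literature.Barriers.SmoothPoincare4.TopologicalBarrierFour (file TopologicalInvariantsBlind.lean):
consistent — no homeomorphism invariant is used; |K| ≃ₜ M is TOP data but the smooth-immersion
clause of `IsSmoothTriangulation` pins the PL = DIFF structure, and the pieces conclude
diffeomorphism.
- Literature.Barriers.SmoothPoincare4.StableBarrierFour (file StableInvariantsBlind.lean):
consistent — no stable or gauge invariant is asked to detect Σ; F is decided row by row by
EXHIBITING Pachner sequences (constructive PL homeomorphisms), never by an invariant.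
- Literature.Barriers.SmoothPoincare4.GaugeSumBarrierFour (file GaugeInvariantsBlind.lean):
consistent — same; Seiberg–Witten/Donaldson data play no role.
- Literature.Barriers.SmoothPoincare4.HCobordismBarrierFour (file HCobordismTheoremFails.lean): not
invoked — no piece infers diffeomorphism from h-cobordism.
- Literature.Barriers.SmoothPoincare4.HCobordismInvariantBarrierFour (file
HCobordismInvariantsBlind.lean): consistent — no h-cobordism invariant is used.
- Literature.Barriers.SmoothPoincare4.CappellShanesonFamilyBarrier (file
CappellShanesonFamilyStandard.lean): inside F as DECIDED-IN-PRINT context only — the CS spheres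
known standard (Akbulut, Gompf) say nothing about the census sphere S⁴_C built from the cut-open CS
complex; S⁴_C is an undecided row, not a corollary.
- Literature.Barriers.SmoothPoincare4.StrictPropertyTwoRBarrier (fi

sub-problem: SmoothPoincare4 · status: open · opened planner-decomp-sp4-writer-1-g3-0 2026-08-30T08:05:43Z · rev 0 · ledger route-SmoothPoincare4-RootDecompAA
GENERATED by the gate from the ledger (D-0016/17). Provers cite these decls: `theorem foo : Summit.SmoothPoincare4.SmoothPoincare4.Theses.RootDecompAA.<Decl> := …` in Summits/SmoothPoincare4/SmoothPoincare4/Theorems/<Name>.lean.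
-/

namespace Summit.SmoothPoincare4.SmoothPoincare4.Theses.RootDecompAA

open scoped BigOperators Topology Manifold Classical MeasureTheory ProbabilityTheory Matrix InnerProductSpace ComplexConjugate ContinuousMap
open Filter Set Function TopologicalSpace MeasureTheory

attribute [summit_statement] _root_.SmoothPoincare4

open Literature.SPC4

/-- item stmt-SmoothPoincare4-30732 · crux · rank 2 · open · by planner
why it might fail: S⁴_C (eAMPcaabcddd+aoa+aAa8aQara, 4 pentachora, sd² = 57600 facets) or one of the ≤ 3 unresolved 6-pentachoron S⁴-classes is PL-exotic — excess-height-6 searches cannot standardise them (arXiv:2412.04768 Prop. 9); that would refute SPC4 itself.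
sources: arXiv:2412.04768, arXiv:2502.01757, Munkres1966, Whitehead1940, book:graham1996-handbook-combinatorics-vol-1
[crux] F (NEW, FINITE RANGE, the node's INSTRUMENTED piece): for every smooth homotopy 4-sphere M
(Statement binders, e : M ≃ₕ S⁴), IF M admits a Whitehead smooth triangulation (K ⊆ E^{N₀} a finite
Euclidean simplicial complex, h : |K| ≃ₜ M smooth with injective derivative on every closed simplex
— tree `IsSmoothTriangulation 4 K h`) whose number of faces with 5 vertices is ≤ 86400, THEN M ≅ S⁴.
Finitely many isomorphism types of complexes are concerned; decided rows = the census classes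
connected to the standard sphere and every complex with ≤ 8 vertices; undecided named rows = S⁴_C
and ≤ 3 six-pentachoron classes. [critic decomp-sp4-crit-1 g3 CLEARED HOME/STATUS.md line 361
2026-08-30T07:59:38Z (ledger row 80; advisory letter Z — taken meanwhile by
route-SmoothPoincare4-RootDecompZ = lens-3 g8 CrossSectionTransfer, opened 08:00:44Z by the lens
seat itself; FacetCensus is therefore born under the first two-letter slug AA): F NEW crux r2 ·
FINITE RANGE · WEAKER by FINITENESS only (F ⟹ S would need sf bounded on homotopy spheres — nothing
in print; BC2 F→S, T→S, F→T, T→F 10/10 FAIL) · NOT DECIDABLE AS A WHOLE (rows decided only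
positively by exhibited Pachner sequences / polytopalit -/
@[route_item "route-SmoothPoincare4-RootDecompAA", crux]
def SmallSpheresStandard : Prop :=
  open scoped ContDiff in ∀ (M : Type) [TopologicalSpace M] [T2Space M] [SecondCountableTopology M] [ChartedSpace (EuclideanSpace ℝ (Fin 4)) M] [IsManifold (𝓡 4) ∞ M], ContinuousMap.HomotopyEquiv M (Metric.sphere (0 : EuclideanSpace ℝ (Fin 5)) 1) → (∃ (N₀ : ℕ) (K : Geometry.SimplicialComplex ℝ (EuclideanSpace ℝ (Fin N₀))) (h : K.space ≃ₜ M) (F : Finset (Finset (EuclideanSpace ℝ (Fin N₀)))), Literature.Topology.FourManifolds.IsSmoothTriangulation 4 K h ∧ (↑F : Set (Finset (EuclideanSpace ℝ (Fin N₀)))) = K.faces ∧ (F.filter (fun s => s.card = 5)).card ≤ 86400) → Nonempty (M ≃ₘ⟮𝓡 4, 𝓡 4⟯ (Metric.sphere (0 : EuclideanSpace ℝ (Fin 5)) 1))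

/-- item stmt-SmoothPoincare4-30733 · crux · rank 3 · open · by planner
why it might fail: An exotic 4-sphere all of whose smooth triangulations are large (sf > 86400) — e.g. a Gluck twist of a high-crossing 2-knot if exotic; nothing bounds sf of a homotopy sphere from above, so T is SPC4 outside a finite set of PL types.
sources: arXiv:2412.04768, Munkres1966, Kirby1997, FreedmanGompfMorrisonWalker2010
[crux] T (NEW, DECLARED RESIDUAL — the dial's complement): for every smooth homotopy 4-sphere M
(Statement binders), IF M admits NO Whitehead smooth triangulation with ≤ 86400 four-simplices, THEN
M ≅ S⁴. Kernel: T ⟺ S given F (`large_iff_summit_of_small`), S ⟹ T, E(86400) ⟹ T where E(N) = «every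
homotopy 4-sphere has sf ≤ N» (E ⟹ finitely many smooth structures on S⁴, on paper). No decided rows
are possible without lower bounds on sf beyond f-vector inequalities: the honest residual. [critic
decomp-sp4-crit-1 g3 CLEARED HOME/STATUS.md line 361 2026-08-30T07:59:38Z (ledger row 80; advisory
letter Z — taken meanwhile by route-SmoothPoincare4-RootDecompZ = lens-3 g8 CrossSectionTransfer,
opened 08:00:44Z by the lens seat itself; FacetCensus is therefore born under the first two-letter
slug AA): T NEW crux r3 · DECLARED RESIDUAL · ≡ S mod F (kernel large_iff_summit_of_small) ·
distribution shape (c) «everything minus a finite set», ADMISSIBLE under R1 + ruling (a) 281 because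
the finite side has NAMED OPEN ROWS with a working external instrument (T-PL6) and the dial is
kernel-monotone (summit_iff_pl N, smallPL_anti, largePL_mono) · BC7 CLEAN] [difficulty:
open-problem] -/
@[route_item "route-SmoothPoincare4-RootDecompAA", crux]
def LargeSpheresStandard : Prop :=
  open scoped ContDiff in ∀ (M : Type) [TopologicalSpace M] [T2Space M] [SecondCountableTopology M] [ChartedSpace (EuclideanSpace ℝ (Fin 4)) M] [IsManifold (𝓡 4) ∞ M], ContinuousMap.HomotopyEquiv M (Metric.sphere (0 : EuclideanSpace ℝ (Fin 5)) 1) → ¬ (∃ (N₀ : ℕ) (K : Geometry.SimplicialComplex ℝ (EuclideanSpace ℝ (Fin N₀))) (h : K.space ≃ₜ M) (F : Finset (Finset (EuclideanSpace ℝ (Fin N₀)))), Literature.Topology.FourManifolds.IsSmoothTriangulation 4 K h ∧ (↑F : Set (Finset (EuclideanSpace ℝ (Fin N₀)))) = K.faces ∧ (F.filter (fun s => s.card = 5)).card ≤ 86400) → Nonempty (M ≃ₘ⟮𝓡 4, 𝓡 4⟯ (Metric.sphere (0 : EuclideanSpace ℝ (Fin 5)) 1))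

/-- item stmt-SmoothPoincare4-30734 · assembly · rank 1 · open · by planner
why it might fail: it does not (kernel-proved `FacetCensus.closes_inline`, a case split).
sources: arXiv:2412.04768
[assembly] the flattened deciding chain F → T → SmoothPoincare4 (kept for the schema; the deciding
theorem is `closes` in route/glue.lean; file `aside` if BC6 requires). [deps: SmallSpheresStandard,
LargeSpheresStandard] [difficulty: provable-now] -/
@[route_item "route-SmoothPoincare4-RootDecompAA"]
def Assembly : Prop :=
  Summit.SmoothPoincare4.SmoothPoincare4.Theses.RootDecompAA.SmallSpheresStandard → Summit.SmoothPoincare4.SmoothPoincare4.Theses.RootDecompAA.LargeSpheresStandard → _root_.SmoothPoincare4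

/-! D-0027 §2.1 — DECIDING THEOREM (planner-authored via `route open/edit --closes-file`; by planner-decomp-sp4-writer-1-g3-0 2026-08-30T08:05:43Z):
its hypotheses are this route's items and its conclusion the sub-problem Statement (glue_lint), and it elaborates with this file. -/

-- Deciding theorem of the gen-8 OR-sibling root route «FacetCensus» (lens-5 g8) over its TWO items:
-- SmallSpheresStandard (F, NEW crux, finite range) and LargeSpheresStandard (T, NEW crux, declared residual).
-- Text = lens certificate `FacetCensus.closes_inline` (g8/FacetCensus.lean, rc 0, axioms {propext, Classical.choice, Quot.sound}); pure logic (case split).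
@[closes "route-SmoothPoincare4-RootDecompAA"] theorem closes (hF : SmallSpheresStandard) (hT : LargeSpheresStandard) : _root_.SmoothPoincare4 := by
  intro M _ _ _ _ _ e
  by_cases hP : (∃ (N₀ : ℕ) (K : Geometry.SimplicialComplex ℝ (EuclideanSpace ℝ (Fin N₀))) (h : K.space ≃ₜ M) (F : Finset (Finset (EuclideanSpace ℝ (Fin N₀)))), Literature.Topology.FourManifolds.IsSmoothTriangulation 4 K h ∧ (↑F : Set (Finset (EuclideanSpace ℝ (Fin N₀)))) = K.faces ∧ (F.filter (fun s => s.card = 5)).card ≤ 86400)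
  · exact hF M e hP
  · exact hT M e hP

end Summit.SmoothPoincare4.SmoothPoincare4.Theses.RootDecompAA
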